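import Literature.AlgebraicGeometry.Resolution.BennettDimOne
import HarnessLib

/-!
# Bennett's inequality `H^{(s+1+d)}[R_𝔭] ≤ H^{(s+1)}[R]` for all primes of a local ring whose
# one-dimensional local quotients have finite normalization (HIO Thm. (30.2); CJS Thm. 2.33 (1))

Topic: `Literature/AlgebraicGeometry/Resolution`. Herrmann–Ikeda–Orbanz, *Equimultiplicity and
Blowing up*, Thm. (30.2) (Bennett): for an excellent local ring `R` and a prime `𝔭` with
`dim R/𝔭 = d`, `H^{(0)}[R] ≥ H^{(d)}[R_𝔭]`; Cossart–Jannsen–Saito, LNM 2270, Thm. 2.33 (1). This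
file assembles the general-`d` statement, in the Bennett–Hironaka form `H^{(s+1+d)}[R_𝔭] ≤
H^{(s+1)}[R]`, from

* the reduction to adjacent primes (`hilbertSamuelFun_add_succ_le_of_forall_covBy`,
  `BennettDimOne.lean`, the first paragraph of the printed proof), and
* the case `d = 1` (`hilbertSamuelFun_add_two_le_of_ringKrullDim_quotient_eq_one`,
  `BennettDimOne.lean`) applied to the local rings `R_𝔔` and their primes `𝔮R_𝔔` for adjacent
  `𝔮 ⋖ 𝔔` (`dim R_𝔔/𝔮R_𝔔 = 1`, `ringKrullDim_localization_quotient_map_eq_one`;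
  `(R_𝔔)_{𝔮R_𝔔} = R_𝔮`),

for every Noetherian local ring `R` all of whose one-dimensional local domains `R_𝔔/𝔮R_𝔔`
(`𝔮 ⋖ 𝔔`) have finite normalization — the hypothesis `hFN`, which is where the source uses the
excellence of `R` ("Now we use the excellence of `R`. Then `N` is a finite `R̄`-module"):
`hilbertSamuelFun_add_succ_le_of_ringKrullDim_quotient_eq` (for `Localization.AtPrime 𝔭` and for any
localization `Rp` of `R` at `𝔭`). No definitions and no named facts are introduced.

## Sources

* M. Herrmann, S. Ikeda, U. Orbanz, *Equimultiplicity and Blowing up*, Springer 1988, Ch. VI,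
  Thm. (30.2) and its proof (p. 251–252). [HerrmannIkedaOrbanz1988]
* V. Cossart, U. Jannsen, S. Saito, LNM 2270 (2020), Thm. 2.33 (1). [CossartJannsenSaito2020]
-/

noncomputable section

open IsLocalRing Literature.RingTheory.HilbertSamuel

namespace Literature.AlgebraicGeometry.Resolution

universe u

variable {R : Type u} [CommRing R]

/-! ## Adjacent primes: `dim R_𝔔/𝔮R_𝔔 = 1` -/

/-- For adjacent primes `𝔮 ⊊ 𝔔` (no prime strictly in between), the local domain `R_𝔔/𝔮R_𝔔` has
dimension one: its primes correspond to the primes of `R` between `𝔮` and `𝔔`. [folklore] -/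
theorem ringKrullDim_localization_quotient_map_eq_one {q Q : Ideal R} [q.IsPrime] [Q.IsPrime]
    (hqQ : q < Q) (hadj : ∀ r : Ideal R, r.IsPrime → q ≤ r → r ≤ Q → r = q ∨ r = Q) :
    ringKrullDim (Localization.AtPrime Q ⧸ q.map (algebraMap R (Localization.AtPrime Q))) = 1 := by
  set R' := Localization.AtPrime Q
  set q' := q.map (algebraMap R R') with hq'
  have hdisj : Disjoint (Q.primeCompl : Set R) q := by
    rw [Set.disjoint_left]
    intro r hr hrq
    exact hr (hqQ.le hrq)
  haveI hq'p : q'.IsPrime := IsLocalization.isPrime_of_isPrime_disjoint Q.primeCompl R' q ‹_› hdisj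
  have hunder : q'.comap (algebraMap R R') = q :=
    IsLocalization.under_map_of_isPrime_disjoint Q.primeCompl R' ‹_› hdisj
  haveI : IsDomain (R' ⧸ q') := Ideal.Quotient.isDomain q'
  haveI : IsLocalRing (R' ⧸ q') :=
    IsLocalRing.of_surjective' (Ideal.Quotient.mk q') Ideal.Quotient.mk_surjective
  have hQ' : (maximalIdeal R').comap (algebraMap R R') = Q := by
    rw [← Ideal.under_def]; exact IsLocalization.AtPrime.under_maximalIdeal R' Q
  -- every prime of `R'` above `q'` is `q'` or the maximal ideal
  have key : ∀ P : Ideal R', P.IsPrime → q' ≤ P → P = q' ∨ P = maximalIdeal R' := by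
    intro P hP hle
    have hPc : (P.comap (algebraMap R R')).IsPrime := Ideal.comap_isPrime _ _
    have h1 : q ≤ P.comap (algebraMap R R') := by rw [← hunder]; exact Ideal.comap_mono hle
    have h2 : P.comap (algebraMap R R') ≤ Q := by
      have := Ideal.comap_mono (f := algebraMap R R') (IsLocalRing.le_maximalIdeal hP.ne_top)
      rwa [hQ'] at this
    rcases hadj _ hPc h1 h2 with h | h
    · left
      rw [← IsLocalization.map_under Q.primeCompl R' P, Ideal.under_def, h]
    · right
      rw [← IsLocalization.map_under Q.primeCompl R' P, Ideal.under_def, h,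
        IsLocalization.AtPrime.map_eq_maximalIdeal]
  -- dimension `≤ 1`
  haveI : Ring.KrullDimLE 1 (R' ⧸ q') := by
    refine Ring.krullDimLE_one_iff_of_isPrime_bot.mpr fun I hI hIp => ?_
    have hIc : (I.comap (Ideal.Quotient.mk q')).IsPrime := Ideal.comap_isPrime _ _
    have hle : q' ≤ I.comap (Ideal.Quotient.mk q') := by
      intro a ha
      rw [Ideal.mem_comap, Ideal.Quotient.eq_zero_iff_mem.mpr ha]
      exact I.zero_mem
    rcases key _ hIc hle with h | h
    · exfalso
      apply hI
      rw [eq_bot_iff]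
      intro a ha
      obtain ⟨a, rfl⟩ := Ideal.Quotient.mk_surjective a
      have : a ∈ I.comap (Ideal.Quotient.mk q') := ha
      rw [h] at this
      rw [Ideal.mem_bot, Ideal.Quotient.eq_zero_iff_mem]
      exact this
    · have hmax : (I.comap (Ideal.Quotient.mk q')).IsMaximal := by rw [h]; infer_instance
      have hI' : I = (I.comap (Ideal.Quotient.mk q')).map (Ideal.Quotient.mk q') :=
        (Ideal.map_comap_of_surjective _ Ideal.Quotient.mk_surjective I).symm
      rcases Ideal.map_eq_top_or_isMaximal_of_surjective (Ideal.Quotient.mk q')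
        Ideal.Quotient.mk_surjective hmax with htop | hm
      · exact absurd (hI'.trans htop) hIp.ne_top
      · rwa [← hI'] at hm
  -- dimension `≥ 1`: `⊥ < 𝔪`
  have hne : (⊥ : Ideal (R' ⧸ q')) ≠ maximalIdeal (R' ⧸ q') := by
    intro h
    -- `q' ≠ 𝔪_{R'}` since `q ≠ Q`
    have hq'ne : q' ≠ maximalIdeal R' := by
      intro h'
      apply hqQ.ne
      rw [← hunder, h', hQ']
    apply hq'ne
    have h2 : (maximalIdeal (R' ⧸ q')).comap (Ideal.Quotient.mk q') = maximalIdeal R' := by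
      haveI : ((maximalIdeal (R' ⧸ q')).comap (Ideal.Quotient.mk q')).IsMaximal :=
        Ideal.comap_isMaximal_of_surjective _ Ideal.Quotient.mk_surjective
      exact IsLocalRing.eq_maximalIdeal inferInstance
    rw [← h2, ← h, ← RingHom.ker_eq_comap_bot, Ideal.mk_ker]
  have hle : ringKrullDim (R' ⧸ q') ≤ 1 := by
    have := Ring.krullDimLE_iff.mp ‹Ring.KrullDimLE 1 (R' ⧸ q')›
    exact_mod_cast this
  have hge : 1 ≤ ringKrullDim (R' ⧸ q') := by
    rw [ringKrullDim, Order.one_le_krullDim_iff]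
    refine ⟨⟨⊥, Ideal.isPrime_bot⟩, ⟨maximalIdeal _, inferInstance⟩, ?_⟩
    exact lt_of_le_of_ne bot_le (fun h' => hne (congrArg PrimeSpectrum.asIdeal h'))
  exact le_antisymm hle hge

/-- `H^{(t)}` is invariant under isomorphisms of Noetherian local rings. [folklore] -/
theorem hilbertSamuelFun_congr_ringEquiv {A : Type u} {B : Type u} [CommRing A] [CommRing B]
    [IsLocalRing A] [IsLocalRing B] [IsNoetherianRing A] (e : A ≃+* B) (t : ℕ) :
    hilbertSamuelFun A t = hilbertSamuelFun B t := by
  show iterPSum t (hilbertFun A) = iterPSum t (hilbertFun B)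
  rw [hilbertFun_eq_of_ringEquiv e]

/-! ## Bennett for adjacent primes, and for all primes -/

section Local

variable [IsLocalRing R] [IsNoetherianRing R]

omit [IsLocalRing R] in
/-- **`H^{(s+2)}[R_𝔮] ≤ H^{(s+1)}[R_𝔔]` for adjacent primes `𝔮 ⋖ 𝔔`** whose one-dimensional local
domain `R_𝔔/𝔮R_𝔔` has finite normalization: the case `d = 1` of Bennett's inequality for
`(R_𝔔, 𝔮R_𝔔)`, transported along `(R_𝔔)_{𝔮R_𝔔} = R_𝔮`.
[cite: HerrmannIkedaOrbanz1988, Thm. (30.2)] -/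
theorem hilbertSamuelFun_add_two_le_of_covBy {q Q : Ideal R} [q.IsPrime] [Q.IsPrime] (hqQ : q < Q)
    (hadj : ∀ r : Ideal R, r.IsPrime → q ≤ r → r ≤ Q → r = q ∨ r = Q)
    (hFN : ∀ [(q.map (algebraMap R (Localization.AtPrime Q))).IsPrime],
      Module.Finite
        (algebraMap (Localization.AtPrime Q ⧸ q.map (algebraMap R (Localization.AtPrime Q)))
          (FractionRing (Localization.AtPrime Q ⧸ q.map (algebraMap R (Localization.AtPrime Q))))).range
        (integralClosure
          (algebraMap (Localization.AtPrime Q ⧸ q.map (algebraMap R (Localization.AtPrime Q)))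
            (FractionRing (Localization.AtPrime Q ⧸ q.map (algebraMap R (Localization.AtPrime Q))))).range
          (FractionRing (Localization.AtPrime Q ⧸ q.map (algebraMap R (Localization.AtPrime Q))))))
    (s : ℕ) :
    hilbertSamuelFun (Localization.AtPrime q) (s + 2) ≤
      hilbertSamuelFun (Localization.AtPrime Q) (s + 1) := by
  set R' := Localization.AtPrime Q
  set q' := q.map (algebraMap R R') with hq'
  have hdisj : Disjoint (Q.primeCompl : Set R) q := by
    rw [Set.disjoint_left]
    intro r hr hrq
    exact hr (hqQ.le hrq)
  haveI hq'p : q'.IsPrime := IsLocalization.isPrime_of_isPrime_disjoint Q.primeCompl R' q ‹_› hdisj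
  have hunder : q'.comap (algebraMap R R') = q :=
    IsLocalization.under_map_of_isPrime_disjoint Q.primeCompl R' ‹_› hdisj
  have hdim : ringKrullDim (R' ⧸ q') = 1 := ringKrullDim_localization_quotient_map_eq_one hqQ hadj
  -- Bennett `d = 1` for `(R', q')`
  have hB := hilbertSamuelFun_add_two_le_of_ringKrullDim_quotient_eq_one (R := R') q' hdim
    (K := FractionRing (R' ⧸ q')) hFN s
  -- `(R')_{q'} ≅ R_q`
  haveI h1 : IsLocalization.AtPrime (Localization.AtPrime q') (q'.comap (algebraMap R R')) :=
    IsLocalization.isLocalization_isLocalization_atPrime_isLocalization Q.primeCompl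
      (T := Localization.AtPrime q') q'
  have hM : q.primeCompl = (q'.comap (algebraMap R R')).primeCompl := by
    ext r
    change r ∉ q ↔ r ∉ q'.comap (algebraMap R R')
    rw [hunder]
  haveI h2 : IsLocalization q.primeCompl (Localization.AtPrime q') := by
    rw [hM]; exact h1
  have e : Localization.AtPrime q' ≃+* Localization.AtPrime q :=
    (IsLocalization.algEquiv q.primeCompl (Localization.AtPrime q') (Localization.AtPrime q)).toRingEquiv
  rw [← hilbertSamuelFun_congr_ringEquiv e]
  exact hB

/-- **Bennett's inequality (Bennett–Hironaka form) for all primes of a Noetherian local ring all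
of whose one-dimensional local domains `R_𝔔/𝔮R_𝔔`, `𝔮 ⋖ 𝔔`, have finite normalization** (e.g.
`R` excellent): if `dim R/𝔭 = d` then `H^{(s+1+d)}[R_𝔭] ≤ H^{(s+1)}[R]` for all `s`.
[cite: HerrmannIkedaOrbanz1988, Thm. (30.2)] [cite: CossartJannsenSaito2020, Thm. 2.33 (1)] -/
theorem hilbertSamuelFun_add_succ_le_of_ringKrullDim_quotient_eq
    (hFN : ∀ (q Q : Ideal R) [q.IsPrime] [Q.IsPrime], q < Q →
      (∀ r : Ideal R, r.IsPrime → q ≤ r → r ≤ Q → r = q ∨ r = Q) →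
      ∀ [(q.map (algebraMap R (Localization.AtPrime Q))).IsPrime],
      Module.Finite
        (algebraMap (Localization.AtPrime Q ⧸ q.map (algebraMap R (Localization.AtPrime Q)))
          (FractionRing (Localization.AtPrime Q ⧸ q.map (algebraMap R (Localization.AtPrime Q))))).range
        (integralClosure
          (algebraMap (Localization.AtPrime Q ⧸ q.map (algebraMap R (Localization.AtPrime Q)))
            (FractionRing (Localization.AtPrime Q ⧸ q.map (algebraMap R (Localization.AtPrime Q))))).range
          (FractionRing (Localization.AtPrime Q ⧸ q.map (algebraMap R (Localization.AtPrime Q))))))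
    (d : ℕ) (p : Ideal R) [p.IsPrime] (hd : ringKrullDim (R ⧸ p) = d) (s : ℕ) :
    hilbertSamuelFun (Localization.AtPrime p) (s + 1 + d) ≤ hilbertSamuelFun R (s + 1) :=
  hilbertSamuelFun_add_succ_le_of_forall_covBy
    (fun q Q _ _ hqQ hadj s => hilbertSamuelFun_add_two_le_of_covBy hqQ hadj (hFN q Q hqQ hadj) s)
    d p hd s

/-- The same for any localization `Rp` of `R` at `𝔭` (e.g. the local ring `𝒪_{X,y}` of a
generization). [cite: HerrmannIkedaOrbanz1988, Thm. (30.2)] -/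
theorem hilbertSamuelFun_add_succ_le_of_ringKrullDim_quotient_eq'
    (hFN : ∀ (q Q : Ideal R) [q.IsPrime] [Q.IsPrime], q < Q →
      (∀ r : Ideal R, r.IsPrime → q ≤ r → r ≤ Q → r = q ∨ r = Q) →
      ∀ [(q.map (algebraMap R (Localization.AtPrime Q))).IsPrime],
      Module.Finite
        (algebraMap (Localization.AtPrime Q ⧸ q.map (algebraMap R (Localization.AtPrime Q)))
          (FractionRing (Localization.AtPrime Q ⧸ q.map (algebraMap R (Localization.AtPrime Q))))).range
        (integralClosure
          (algebraMap (Localization.AtPrime Q ⧸ q.map (algebraMap R (Localization.AtPrime Q)))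
            (FractionRing (Localization.AtPrime Q ⧸ q.map (algebraMap R (Localization.AtPrime Q))))).range
          (FractionRing (Localization.AtPrime Q ⧸ q.map (algebraMap R (Localization.AtPrime Q))))))
    (d : ℕ) (p : Ideal R) [p.IsPrime] (Rp : Type u) [CommRing Rp] [Algebra R Rp]
    [IsLocalization.AtPrime Rp p] [IsLocalRing Rp] (hd : ringKrullDim (R ⧸ p) = d) (s : ℕ) :
    hilbertSamuelFun Rp (s + 1 + d) ≤ hilbertSamuelFun R (s + 1) := by
  have e : Localization.AtPrime p ≃+* Rp :=
    (IsLocalization.algEquiv p.primeCompl (Localization.AtPrime p) Rp).toRingEquiv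
  rw [← hilbertSamuelFun_congr_ringEquiv e]
  exact hilbertSamuelFun_add_succ_le_of_ringKrullDim_quotient_eq hFN d p hd s

end Local

end Literature.AlgebraicGeometry.Resolution
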